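/-
Copyright (c) 2026 the pub-hodgecm-mathlib formalisation cell (harness21).  Prover seat hodgecm-mathlib-K2E3-p21 (g4), Track B «K2-LIT» ∕ h413
(`stmt-HodgeConjecture-24833`), line `K2_E3_EllipticInputs`, unit U12 §L, Richardson road for (LBGL-ge3) at `N = 3` (road owner K2E3-p11 (g4), deal (F-E)-D′
2026-09-04T05:21Z), part 1 of 2: «LEBESGUE MEASURE ON THE LEVI SLICE `𝔪_{(2,1)} ⊂ 𝔤𝔩₃(F)` IS `Ad(M_{(2,1)})`-INVARIANT».  2026-09-04.
-/
import Literature.NumberTheory.Automorphic.GLnLeviQuotientIwasawaIntegration           -- ★ `mem_standardLeviGL_iff` (via `GLnTwoBlockLeviStructure`), local-field frame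
import Literature.MeasureTheory.Group.LocalFieldLinearJacobian                           -- ★ `lintegral_comp_linearEquiv` (`∫ f∘L = mod_F(det L)⁻¹ ∫ f` on `Fᵈ`)
import HarnessLib

/-!
# K2_E3 road (h413), §L — Richardson road for (LBGL-ge3) at `N = 3`, brick (F-E)-D′ part 1: the Levi slice `𝔪 = 𝔪_{(2,1)} ≅ F⁵` of `𝔤𝔩₃(F)`,
# `Ad(M_c)`-invariance of its Lebesgue measure, and right-`M_c`-invariance of the weighted slice functional `Ψ_h(y) = ∫_𝔪 w(χ(m)) h(y M(m) y⁻¹) dm`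

Cell `pub/hodgecm-mathlib` (D-0151), Track B, seat K2E3-p21 (g4); road owner K2E3-p11 (g4) (05:21:40Z: «(F-E)-D′ `K2E3GL3ParabolicSliceAdInvariant` … the
`dm`-integral makes `g ↦ ∫ |χ| h(Ad g M) dm` right-`M_c`-invariant»), §L lead K2E3-p12 (g4), dealer K2E3-plan (g3).  `--supports stmt-HodgeConjecture-24833 --as helper`;
THEOREMS ONLY (no definition ∕ instance ∕ notation ∕ named fact ∕ `sorry`); never imports `Cruxes/…/Lines`.  COUNT-NEUTRAL ((LBGL-ge3) stays OPEN).  Consumer: part 2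
`K2E3GL3ParabolicSliceAdInvariant` (the quotient-measure argument on `GL₃ ⧸ M_c` and the heads).

THE MATHEMATICS.  `c = (false,false,true)`, `M_c ≅ GL₂ × GL₁ ≤ GL₃(F)` block diagonal, `𝔪 ≅ F⁵` via `M(m) = [[m₀,m₁,0],[m₂,m₃,0],[0,0,m₄]]`,
`χ(m) = χ_{[[m₀,m₁],[m₂,m₃]]}(m₄)`.  For block-diagonal `A, B` (`a ∈ M_c`, `A = a`, `B = a⁻¹`), `A · M(m) · B = M(T(A,B) m)` with the `5×5` coordinate matrix
`T(A,B) = (P ⊗ Qᵀ) ⊕ (A₂₂B₂₂)` (`P`, `Q` the `2×2` blocks), `det T = (det P det Q)² A₂₂B₂₂ = 1` when `A B = 1` (§1); hence `dm = dx^{⊗5}` is `Ad(M_c)`-invariant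
(★ `lintegral_comp_linearEquiv`, §2), `χ ∘ Ad(a) = χ` (`Matrix.charpoly_mul_comm`), and `Ψ_h(y a) = Ψ_h(y)` for `a ∈ M_c`, `Ψ_h` Borel on `GL₃(F)` (§3).
[HarishChandra1970, Part V §2 p. 49]; [Rogawski1990, §4.13 p. 70]; [WeilBNT1967, Ch. I §2 (module of a linear automorphism)].

HONEST LABEL: HC_CM is proved only modulo the 7 printed citations (2 remaining named inputs: hLiu418 = stmt-HodgeConjecture-24832, h413 = stmt-HodgeConjecture-24833)
until rung 0 closes; count-neutral helper.
-/

set_option autoImplicit false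
set_option linter.dupNamespace false   -- `Summit.HodgeConjecture.HodgeConjecture.…` (D-0017 nested layout; lakefile exemption for Summits)

noncomputable section

open MeasureTheory MeasureTheory.Measure Filter Topology TopologicalSpace Polynomial Function
open scoped MatrixGroups NNReal ENNReal
open Literature.NumberTheory.Automorphic
open Literature.NumberTheory.GaloisRepresentations Literature.NumberTheory.GaloisRepresentations.IsNonarchimedeanLocalField

namespace Summit.HodgeConjecture.HodgeConjecture.Cruxes.H413.K2E3GL3LeviSliceAdInvariant

/-! ## §1  Algebra of the Levi slice `𝔪_{(2,1)} ≅ F⁵`: `Ad(a)`, `a ∈ M_c`, in the coordinates `m`, its matrix `T(a, a⁻¹)` and determinant, and `χ ∘ Ad(a) = χ` -/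

section Algebra

variable {R : Type*} [CommRing R]

/-- For block-diagonal `A, B` (zero off-diagonal `(2,1)` blocks), `A · M(m) · B` is again block diagonal: it is `M` of its own five block entries. [folklore] -/
theorem conj_leviBlock_eq (A B : Matrix (Fin 3) (Fin 3) R) (m : Fin 5 → R)
    (hA02 : A 0 2 = 0) (hA12 : A 1 2 = 0) (hA20 : A 2 0 = 0) (hA21 : A 2 1 = 0)
    (hB02 : B 0 2 = 0) (hB12 : B 1 2 = 0) (hB20 : B 2 0 = 0) (hB21 : B 2 1 = 0) :
    A * !![m 0, m 1, 0; m 2, m 3, 0; 0, 0, m 4] * B =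
      !![(A * !![m 0, m 1, 0; m 2, m 3, 0; 0, 0, m 4] * B) 0 0, (A * !![m 0, m 1, 0; m 2, m 3, 0; 0, 0, m 4] * B) 0 1, 0;
         (A * !![m 0, m 1, 0; m 2, m 3, 0; 0, 0, m 4] * B) 1 0, (A * !![m 0, m 1, 0; m 2, m 3, 0; 0, 0, m 4] * B) 1 1, 0;
         0, 0, (A * !![m 0, m 1, 0; m 2, m 3, 0; 0, 0, m 4] * B) 2 2] := by
  ext i j
  fin_cases i <;> fin_cases j <;> simp [Matrix.mul_apply, Fin.sum_univ_three, hA02, hA12, hA20, hA21, hB02, hB12, hB20, hB21]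

/-- The coordinate matrix `T(A, B) = (P ⊗ Qᵀ) ⊕ (A₂₂ B₂₂)` of `m ↦ A · M(m) · B` (`P`, `Q` the `2×2` blocks of the block-diagonal `A`, `B`): `T(A,B) m` is the
coordinate vector of `A · M(m) · B`. [folklore] -/
theorem leviCoordMatrix_mulVec (A B : Matrix (Fin 3) (Fin 3) R) (m : Fin 5 → R)
    (hA02 : A 0 2 = 0) (hA12 : A 1 2 = 0) (hA20 : A 2 0 = 0) (hA21 : A 2 1 = 0)
    (hB02 : B 0 2 = 0) (hB12 : B 1 2 = 0) (hB20 : B 2 0 = 0) (hB21 : B 2 1 = 0) :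
    (!![A 0 0 * B 0 0, A 0 0 * B 1 0, A 0 1 * B 0 0, A 0 1 * B 1 0, 0;
        A 0 0 * B 0 1, A 0 0 * B 1 1, A 0 1 * B 0 1, A 0 1 * B 1 1, 0;
        A 1 0 * B 0 0, A 1 0 * B 1 0, A 1 1 * B 0 0, A 1 1 * B 1 0, 0;
        A 1 0 * B 0 1, A 1 0 * B 1 1, A 1 1 * B 0 1, A 1 1 * B 1 1, 0;
        0, 0, 0, 0, A 2 2 * B 2 2] : Matrix (Fin 5) (Fin 5) R).mulVec m =
      ![(A * !![m 0, m 1, 0; m 2, m 3, 0; 0, 0, m 4] * B) 0 0, (A * !![m 0, m 1, 0; m 2, m 3, 0; 0, 0, m 4] * B) 0 1,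
        (A * !![m 0, m 1, 0; m 2, m 3, 0; 0, 0, m 4] * B) 1 0, (A * !![m 0, m 1, 0; m 2, m 3, 0; 0, 0, m 4] * B) 1 1,
        (A * !![m 0, m 1, 0; m 2, m 3, 0; 0, 0, m 4] * B) 2 2] := by
  ext i
  fin_cases i <;> simp [Matrix.mulVec, dotProduct, Fin.sum_univ_five, Matrix.mul_apply, Fin.sum_univ_three, hA02, hA12, hA20, hA21, hB02, hB12, hB20, hB21] <;> ring

/-- `det T(A, B) = (det P)² (det Q)² · A₂₂ B₂₂` (`det (P ⊗ Qᵀ) = (det P)² (det Q)²`). [folklore] -/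
theorem det_leviCoordMatrix (A B : Matrix (Fin 3) (Fin 3) R) :
    (!![A 0 0 * B 0 0, A 0 0 * B 1 0, A 0 1 * B 0 0, A 0 1 * B 1 0, 0;
        A 0 0 * B 0 1, A 0 0 * B 1 1, A 0 1 * B 0 1, A 0 1 * B 1 1, 0;
        A 1 0 * B 0 0, A 1 0 * B 1 0, A 1 1 * B 0 0, A 1 1 * B 1 0, 0;
        A 1 0 * B 0 1, A 1 0 * B 1 1, A 1 1 * B 0 1, A 1 1 * B 1 1, 0;
        0, 0, 0, 0, A 2 2 * B 2 2] : Matrix (Fin 5) (Fin 5) R).det =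
      (A 0 0 * A 1 1 - A 0 1 * A 1 0) ^ 2 * (B 0 0 * B 1 1 - B 0 1 * B 1 0) ^ 2 * (A 2 2 * B 2 2) := by
  simp +decide [Matrix.det_succ_row_zero, Fin.sum_univ_succ, Matrix.submatrix, Fin.succAbove]
  ring

/-- For block-diagonal `A, B` with `A B = 1`: `det P · det Q = 1` for the `2×2` blocks and `A₂₂ B₂₂ = 1`, so **`det T(A, B) = 1`**. [folklore] -/
theorem det_leviCoordMatrix_eq_one {A B : Matrix (Fin 3) (Fin 3) R}
    (hA02 : A 0 2 = 0) (hA12 : A 1 2 = 0) (hA20 : A 2 0 = 0) (hA21 : A 2 1 = 0) (hAB : A * B = 1) :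
    (!![A 0 0 * B 0 0, A 0 0 * B 1 0, A 0 1 * B 0 0, A 0 1 * B 1 0, 0;
        A 0 0 * B 0 1, A 0 0 * B 1 1, A 0 1 * B 0 1, A 0 1 * B 1 1, 0;
        A 1 0 * B 0 0, A 1 0 * B 1 0, A 1 1 * B 0 0, A 1 1 * B 1 0, 0;
        A 1 0 * B 0 1, A 1 0 * B 1 1, A 1 1 * B 0 1, A 1 1 * B 1 1, 0;
        0, 0, 0, 0, A 2 2 * B 2 2] : Matrix (Fin 5) (Fin 5) R).det = 1 := by
  have hPQ : (!![A 0 0, A 0 1; A 1 0, A 1 1] : Matrix (Fin 2) (Fin 2) R) * !![B 0 0, B 0 1; B 1 0, B 1 1] = 1 := by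
    ext i j
    fin_cases i <;> fin_cases j
    · simpa [Matrix.mul_apply, Fin.sum_univ_three, hA02] using congrFun (congrFun hAB 0) 0
    · simpa [Matrix.mul_apply, Fin.sum_univ_three, hA02] using congrFun (congrFun hAB 0) 1
    · simpa [Matrix.mul_apply, Fin.sum_univ_three, hA12] using congrFun (congrFun hAB 1) 0
    · simpa [Matrix.mul_apply, Fin.sum_univ_three, hA12] using congrFun (congrFun hAB 1) 1
  have hdet : (A 0 0 * A 1 1 - A 0 1 * A 1 0) * (B 0 0 * B 1 1 - B 0 1 * B 1 0) = 1 := by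
    have h := congrArg Matrix.det hPQ
    rwa [Matrix.det_mul, Matrix.det_one, Matrix.det_fin_two_of, Matrix.det_fin_two_of] at h
  have h22 : A 2 2 * B 2 2 = 1 := by
    simpa [Matrix.mul_apply, Fin.sum_univ_three, hA20, hA21] using congrFun (congrFun hAB 2) 2
  rw [det_leviCoordMatrix, h22, mul_one, ← mul_pow, hdet, one_pow]

/-- **`χ ∘ Ad(a) = χ` on `𝔪`**: for block-diagonal `A, B` with `A B = 1 = B A` and `Z = A · M(m) · B`, `χ_{[[Z₀₀,Z₀₁],[Z₁₀,Z₁₁]]}(Z₂₂) = χ_{[[m₀,m₁],[m₂,m₃]]}(m₄)`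
(the `2×2` block of `Z` is `P Y Q` with `Q P = 1`, `Matrix.charpoly_mul_comm`; `Z₂₂ = A₂₂ m₄ B₂₂ = m₄`). [folklore] -/
theorem eval_charpoly_leviCoords {A B : Matrix (Fin 3) (Fin 3) R} (m : Fin 5 → R)
    (hA02 : A 0 2 = 0) (hA12 : A 1 2 = 0) (hA20 : A 2 0 = 0) (hA21 : A 2 1 = 0)
    (hB02 : B 0 2 = 0) (hB12 : B 1 2 = 0) (hB20 : B 2 0 = 0) (hB21 : B 2 1 = 0) (hAB : A * B = 1) (hBA : B * A = 1)
    {Z : Matrix (Fin 3) (Fin 3) R} (hZ : Z = A * !![m 0, m 1, 0; m 2, m 3, 0; 0, 0, m 4] * B) :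
    (!![Z 0 0, Z 0 1; Z 1 0, Z 1 1] : Matrix (Fin 2) (Fin 2) R).charpoly.eval (Z 2 2) = (!![m 0, m 1; m 2, m 3] : Matrix (Fin 2) (Fin 2) R).charpoly.eval (m 4) := by
  have hQP : (!![B 0 0, B 0 1; B 1 0, B 1 1] : Matrix (Fin 2) (Fin 2) R) * !![A 0 0, A 0 1; A 1 0, A 1 1] = 1 := by
    ext i j
    fin_cases i <;> fin_cases j
    · simpa [Matrix.mul_apply, Fin.sum_univ_three, hB02] using congrFun (congrFun hBA 0) 0
    · simpa [Matrix.mul_apply, Fin.sum_univ_three, hB02] using congrFun (congrFun hBA 0) 1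
    · simpa [Matrix.mul_apply, Fin.sum_univ_three, hB12] using congrFun (congrFun hBA 1) 0
    · simpa [Matrix.mul_apply, Fin.sum_univ_three, hB12] using congrFun (congrFun hBA 1) 1
  have h22 : A 2 2 * B 2 2 = 1 := by
    simpa [Matrix.mul_apply, Fin.sum_univ_three, hA20, hA21] using congrFun (congrFun hAB 2) 2
  have hZ22 : Z 2 2 = m 4 := by
    have : Z 2 2 = A 2 2 * B 2 2 * m 4 := by
      rw [hZ]; simp [Matrix.mul_apply, Fin.sum_univ_three, hA20, hA21, hB02, hB12]; ring
    rw [this, h22, one_mul]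
  have hblock : (!![Z 0 0, Z 0 1; Z 1 0, Z 1 1] : Matrix (Fin 2) (Fin 2) R) =
      !![A 0 0, A 0 1; A 1 0, A 1 1] * !![m 0, m 1; m 2, m 3] * !![B 0 0, B 0 1; B 1 0, B 1 1] := by
    ext i j
    fin_cases i <;> fin_cases j <;> simp [hZ, Matrix.mul_apply, Fin.sum_univ_three, Fin.sum_univ_two, hA02, hA12, hB20, hB21]
  rw [hZ22, hblock, Matrix.charpoly_mul_comm, ← Matrix.mul_assoc, hQP, Matrix.one_mul]

end Algebra

/-! ## §2  Lebesgue measure on `𝔪 ≅ F⁵` is `Ad(M_c)`-invariant -/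

section LeviSlice

variable {F : Type*} [Field F] [ValuativeRel F] [TopologicalSpace F] [IsNonarchimedeanLocalField F] [MeasurableSpace F] [BorelSpace F]

/-- **`dm` is `Ad(M_c)`-invariant**: for block-diagonal `A, B ∈ M₃(F)` with `A B = 1` and every `G : F⁵ → [0, ∞]`,
`∫⁻ G(coords(A · M(m) · B)) dm = ∫⁻ G dm` (`dm = dx^{⊗5}`; the substitution is linear with `det T(A,B) = 1`, ★ `lintegral_comp_linearEquiv`).
[cite: HarishChandra1970, Part V §2 p. 49] -/
theorem lintegral_pi_comp_leviCoords_eq (dx : Measure F) [dx.IsAddHaarMeasure] {A B : Matrix (Fin 3) (Fin 3) F}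
    (hA02 : A 0 2 = 0) (hA12 : A 1 2 = 0) (hA20 : A 2 0 = 0) (hA21 : A 2 1 = 0)
    (hB02 : B 0 2 = 0) (hB12 : B 1 2 = 0) (hB20 : B 2 0 = 0) (hB21 : B 2 1 = 0) (hAB : A * B = 1) (G : (Fin 5 → F) → ℝ≥0∞) :
    ∫⁻ m : Fin 5 → F, G ![(A * !![m 0, m 1, 0; m 2, m 3, 0; 0, 0, m 4] * B) 0 0, (A * !![m 0, m 1, 0; m 2, m 3, 0; 0, 0, m 4] * B) 0 1,
        (A * !![m 0, m 1, 0; m 2, m 3, 0; 0, 0, m 4] * B) 1 0, (A * !![m 0, m 1, 0; m 2, m 3, 0; 0, 0, m 4] * B) 1 1,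
        (A * !![m 0, m 1, 0; m 2, m 3, 0; 0, 0, m 4] * B) 2 2] ∂(Measure.pi fun _ : Fin 5 => dx) =
      ∫⁻ m : Fin 5 → F, G m ∂(Measure.pi fun _ : Fin 5 => dx) := by
  classical
  haveI : T2Space F := (isLocalField F).toT2Space
  haveI : LocallyCompactSpace F := (isLocalField F).toLocallyCompactSpace
  haveI : SecondCountableTopology F := secondCountableTopology_localField F
  haveI : IsTopologicalRing F := inferInstance
  set T : Matrix (Fin 5) (Fin 5) F :=
    !![A 0 0 * B 0 0, A 0 0 * B 1 0, A 0 1 * B 0 0, A 0 1 * B 1 0, 0;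
        A 0 0 * B 0 1, A 0 0 * B 1 1, A 0 1 * B 0 1, A 0 1 * B 1 1, 0;
        A 1 0 * B 0 0, A 1 0 * B 1 0, A 1 1 * B 0 0, A 1 1 * B 1 0, 0;
        A 1 0 * B 0 1, A 1 0 * B 1 1, A 1 1 * B 0 1, A 1 1 * B 1 1, 0;
        0, 0, 0, 0, A 2 2 * B 2 2] with hT
  have hTdet : T.det = 1 := by rw [hT]; exact det_leviCoordMatrix_eq_one hA02 hA12 hA20 hA21 hAB
  set L : (Fin 5 → F) ≃ₗ[F] (Fin 5 → F) := T.toLinearEquiv' (Matrix.invertibleOfIsUnitDet T (by rw [hTdet]; exact isUnit_one)) with hL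
  have hLapp : ∀ m : Fin 5 → F, L m = ![(A * !![m 0, m 1, 0; m 2, m 3, 0; 0, 0, m 4] * B) 0 0, (A * !![m 0, m 1, 0; m 2, m 3, 0; 0, 0, m 4] * B) 0 1,
      (A * !![m 0, m 1, 0; m 2, m 3, 0; 0, 0, m 4] * B) 1 0, (A * !![m 0, m 1, 0; m 2, m 3, 0; 0, 0, m 4] * B) 1 1,
      (A * !![m 0, m 1, 0; m 2, m 3, 0; 0, 0, m 4] * B) 2 2] := fun m => by
    show (L : Module.End F (Fin 5 → F)) m = _
    rw [hL, Matrix.toLinearEquiv'_apply, Matrix.toLin'_apply, hT]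
    exact leviCoordMatrix_mulVec A B m hA02 hA12 hA20 hA21 hB02 hB12 hB20 hB21
  have hLdet : LinearEquiv.det L = 1 := Units.ext (by
    rw [LinearEquiv.coe_det, show (L : (Fin 5 → F) →ₗ[F] (Fin 5 → F)) = Matrix.toLin' T from rfl, LinearMap.det_toLin', hTdet, Units.val_one])
  have h := Literature.MeasureTheory.Group.lintegral_comp_linearEquiv (Measure.pi fun _ : Fin 5 => dx) L G
  rw [hLdet, map_one, inv_one, ENNReal.coe_one, one_mul] at h
  simp_rw [hLapp] at h
  exact h

/-! ## §3  The weighted Levi-slice functional `Ψ_h(y) = ∫_𝔪 w(χ(m)) h(y M(m) y⁻¹) dm` is right-`M_c`-invariant and Borel -/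

/-- **`Ψ_h(y a) = Ψ_h(y)` for `a ∈ M_c`**: with `Ψ_h(y) = ∫⁻_m w(χ(m)) h(y M(m) y⁻¹) dm`, substituting `m ↦ coords(a M(m) a⁻¹)` (§2, measure preserving;
`χ` is invariant, §1) gives right-`M_{(2,1)}`-invariance for every `w, h ≥ 0` (no measurability needed). [cite: HarishChandra1970, Part V §2 p. 49] -/
theorem lintegral_pi_weight_conj_mul_levi_eq (dx : Measure F) [dx.IsAddHaarMeasure] (w : F → ℝ≥0∞) (h : Matrix (Fin 3) (Fin 3) F → ℝ≥0∞)
    (y : GL (Fin 3) F) {a : GL (Fin 3) F} (ha : a ∈ standardLeviGL F (![false, false, true] : Fin 3 → Bool)) :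
    ∫⁻ m : Fin 5 → F, w ((!![m 0, m 1; m 2, m 3] : Matrix (Fin 2) (Fin 2) F).charpoly.eval (m 4)) *
        h (((y * a : GL (Fin 3) F) : Matrix (Fin 3) (Fin 3) F) * !![m 0, m 1, 0; m 2, m 3, 0; 0, 0, m 4] * (((y * a)⁻¹ : GL (Fin 3) F) : Matrix (Fin 3) (Fin 3) F))
        ∂(Measure.pi fun _ : Fin 5 => dx) =
      ∫⁻ m : Fin 5 → F, w ((!![m 0, m 1; m 2, m 3] : Matrix (Fin 2) (Fin 2) F).charpoly.eval (m 4)) *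
        h ((y : Matrix (Fin 3) (Fin 3) F) * !![m 0, m 1, 0; m 2, m 3, 0; 0, 0, m 4] * ((y⁻¹ : GL (Fin 3) F) : Matrix (Fin 3) (Fin 3) F))
        ∂(Measure.pi fun _ : Fin 5 => dx) := by
  classical
  set A : Matrix (Fin 3) (Fin 3) F := (a : Matrix (Fin 3) (Fin 3) F) with hA
  set B : Matrix (Fin 3) (Fin 3) F := ((a⁻¹ : GL (Fin 3) F) : Matrix (Fin 3) (Fin 3) F) with hB
  have hz := (mem_standardLeviGL_iff (![false, false, true] : Fin 3 → Bool) a).1 ha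
  have hz' := (mem_standardLeviGL_iff (![false, false, true] : Fin 3 → Bool) a⁻¹).1 (Subgroup.inv_mem _ ha)
  have hA02 : A 0 2 = 0 := hz 0 2 (by decide)
  have hA12 : A 1 2 = 0 := hz 1 2 (by decide)
  have hA20 : A 2 0 = 0 := hz 2 0 (by decide)
  have hA21 : A 2 1 = 0 := hz 2 1 (by decide)
  have hB02 : B 0 2 = 0 := hz' 0 2 (by decide)
  have hB12 : B 1 2 = 0 := hz' 1 2 (by decide)
  have hB20 : B 2 0 = 0 := hz' 2 0 (by decide)
  have hB21 : B 2 1 = 0 := hz' 2 1 (by decide)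
  have hAB : A * B = 1 := a.mul_inv
  have hBA : B * A = 1 := a.inv_mul
  -- pointwise: the integrand at `m` is `G` at the coordinates of `a M(m) a⁻¹`, `G(m') = w(χ m') h(y M(m') y⁻¹)`
  set G : (Fin 5 → F) → ℝ≥0∞ := fun m' => w ((!![m' 0, m' 1; m' 2, m' 3] : Matrix (Fin 2) (Fin 2) F).charpoly.eval (m' 4)) *
    h ((y : Matrix (Fin 3) (Fin 3) F) * !![m' 0, m' 1, 0; m' 2, m' 3, 0; 0, 0, m' 4] * ((y⁻¹ : GL (Fin 3) F) : Matrix (Fin 3) (Fin 3) F)) with hG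
  have hpt : ∀ m : Fin 5 → F,
      w ((!![m 0, m 1; m 2, m 3] : Matrix (Fin 2) (Fin 2) F).charpoly.eval (m 4)) *
        h (((y * a : GL (Fin 3) F) : Matrix (Fin 3) (Fin 3) F) * !![m 0, m 1, 0; m 2, m 3, 0; 0, 0, m 4] * (((y * a)⁻¹ : GL (Fin 3) F) : Matrix (Fin 3) (Fin 3) F)) =
      G ![(A * !![m 0, m 1, 0; m 2, m 3, 0; 0, 0, m 4] * B) 0 0, (A * !![m 0, m 1, 0; m 2, m 3, 0; 0, 0, m 4] * B) 0 1,
          (A * !![m 0, m 1, 0; m 2, m 3, 0; 0, 0, m 4] * B) 1 0, (A * !![m 0, m 1, 0; m 2, m 3, 0; 0, 0, m 4] * B) 1 1,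
          (A * !![m 0, m 1, 0; m 2, m 3, 0; 0, 0, m 4] * B) 2 2] := fun m => by
    have hZ := conj_leviBlock_eq A B m hA02 hA12 hA20 hA21 hB02 hB12 hB20 hB21
    have hχ := eval_charpoly_leviCoords m hA02 hA12 hA20 hA21 hB02 hB12 hB20 hB21 hAB hBA rfl
    simp only [hG, Matrix.cons_val_zero, Matrix.cons_val_one, Matrix.cons_val_two, Matrix.cons_val_three, Matrix.cons_val_four, Matrix.head_cons,
      Matrix.tail_cons]
    rw [hχ, ← hZ]
    congr 2
    rw [Units.val_mul, mul_inv_rev, Units.val_mul, hA, hB]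
    simp only [Matrix.mul_assoc]
  have hfun : (fun m : Fin 5 → F => w ((!![m 0, m 1; m 2, m 3] : Matrix (Fin 2) (Fin 2) F).charpoly.eval (m 4)) *
        h (((y * a : GL (Fin 3) F) : Matrix (Fin 3) (Fin 3) F) * !![m 0, m 1, 0; m 2, m 3, 0; 0, 0, m 4] * (((y * a)⁻¹ : GL (Fin 3) F) : Matrix (Fin 3) (Fin 3) F))) =
      fun m => G ![(A * !![m 0, m 1, 0; m 2, m 3, 0; 0, 0, m 4] * B) 0 0, (A * !![m 0, m 1, 0; m 2, m 3, 0; 0, 0, m 4] * B) 0 1,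
          (A * !![m 0, m 1, 0; m 2, m 3, 0; 0, 0, m 4] * B) 1 0, (A * !![m 0, m 1, 0; m 2, m 3, 0; 0, 0, m 4] * B) 1 1,
          (A * !![m 0, m 1, 0; m 2, m 3, 0; 0, 0, m 4] * B) 2 2] := funext hpt
  rw [hfun]
  exact lintegral_pi_comp_leviCoords_eq dx hA02 hA12 hA20 hA21 hB02 hB12 hB20 hB21 hAB G

variable [MeasurableSpace (Matrix (Fin 3) (Fin 3) F)] [BorelSpace (Matrix (Fin 3) (Fin 3) F)] [MeasurableSpace (GL (Fin 3) F)] [BorelSpace (GL (Fin 3) F)]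

/-- **`(y, m) ↦ w(χ(m)) h(y M(m) y⁻¹)` is Borel on `GL₃(F) × F⁵`** for Borel `w, h`. [folklore] -/
theorem measurable_weight_mul_conj (w : F → ℝ≥0∞) (hw : Measurable w) (h : Matrix (Fin 3) (Fin 3) F → ℝ≥0∞) (hh : Measurable h) :
    Measurable fun p : GL (Fin 3) F × (Fin 5 → F) =>
      w ((!![p.2 0, p.2 1; p.2 2, p.2 3] : Matrix (Fin 2) (Fin 2) F).charpoly.eval (p.2 4)) *
        h ((p.1 : Matrix (Fin 3) (Fin 3) F) * !![p.2 0, p.2 1, 0; p.2 2, p.2 3, 0; 0, 0, p.2 4] * ((p.1⁻¹ : GL (Fin 3) F) : Matrix (Fin 3) (Fin 3) F)) := by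
  classical
  haveI : T2Space F := (isLocalField F).toT2Space
  haveI : SecondCountableTopology F := secondCountableTopology_localField F
  haveI : IsTopologicalRing F := inferInstance
  haveI : SecondCountableTopology (Matrix (Fin 3) (Fin 3) F) := inferInstanceAs (SecondCountableTopology (Fin 3 → Fin 3 → F))
  haveI : SecondCountableTopology (Matrix (Fin 3) (Fin 3) F)ᵐᵒᵖ := MulOpposite.opHomeomorph.symm.secondCountableTopology
  haveI : SecondCountableTopology (GL (Fin 3) F) := Units.isEmbedding_embedProduct.secondCountableTopology
  refine Measurable.mul (hw.comp ?_) (hh.comp ?_)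
  · -- `χ(m) = (m₄ − m₀)(m₄ − m₃) − m₁ m₂` is a polynomial in `m`
    have hχ : (fun p : GL (Fin 3) F × (Fin 5 → F) => ((!![p.2 0, p.2 1; p.2 2, p.2 3] : Matrix (Fin 2) (Fin 2) F).charpoly.eval (p.2 4))) =
        fun p => (p.2 4 - p.2 0) * (p.2 4 - p.2 3) - p.2 1 * p.2 2 := by
      funext p
      rw [Matrix.eval_charpoly, Matrix.det_fin_two]
      simp [Matrix.scalar_apply, Matrix.diagonal, Matrix.of_apply]
    rw [hχ]
    fun_prop
  · refine Continuous.measurable ?_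
    refine ((Units.continuous_val.comp continuous_fst).mul (continuous_matrix fun i j => ?_)).mul (Units.continuous_coe_inv.comp continuous_fst)
    fin_cases i <;> fin_cases j <;> simp <;> fun_prop

/-- **`Ψ_h` is Borel on `GL₃(F)`**: `y ↦ ∫⁻_m w(χ(m)) h(y M(m) y⁻¹) dm` is measurable (Tonelli, `dm` s-finite). [folklore] -/
theorem measurable_lintegral_pi_weight_conj (dx : Measure F) [dx.IsAddHaarMeasure] (w : F → ℝ≥0∞) (hw : Measurable w)
    (h : Matrix (Fin 3) (Fin 3) F → ℝ≥0∞) (hh : Measurable h) :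
    Measurable fun y : GL (Fin 3) F => ∫⁻ m : Fin 5 → F, w ((!![m 0, m 1; m 2, m 3] : Matrix (Fin 2) (Fin 2) F).charpoly.eval (m 4)) *
      h ((y : Matrix (Fin 3) (Fin 3) F) * !![m 0, m 1, 0; m 2, m 3, 0; 0, 0, m 4] * ((y⁻¹ : GL (Fin 3) F) : Matrix (Fin 3) (Fin 3) F)) ∂(Measure.pi fun _ : Fin 5 => dx) := by
  haveI : T2Space F := (isLocalField F).toT2Space
  haveI : LocallyCompactSpace F := (isLocalField F).toLocallyCompactSpace
  haveI : SecondCountableTopology F := secondCountableTopology_localField F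
  haveI : SFinite dx := inferInstance
  exact (measurable_weight_mul_conj w hw h hh).lintegral_prod_right'

end LeviSlice

end Summit.HodgeConjecture.HodgeConjecture.Cruxes.H413.K2E3GL3LeviSliceAdInvariant

end
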